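import Literature.Probability.Moments.BennettBernsteinMeasure
import Literature.Probability.Moments.NonnegativeLowerTail
import Literature.Probability.Moments.SampleVariance
import Mathlib.Probability.IdentDistrib
import HarnessLib

/-!
# An empirical Bernstein bound: for independent draws in `[0, b]` with a common mean `μ`,
# `|X̄_n − μ| ≤ √(2 V̂_n x / n) + 5 b x / n` except on an event of probability `≤ 3 e^{−x}`,
# where `V̂_n = n⁻¹ Σ (X_i − X̄_n)²` is the empirical variance — a data-dependent, non-asymptotic error bar

Topic `Literature/Probability/Moments`; namespace `Literature.Probability.Moments`. A COROLLARY file: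
everything is PROVED (no definition, no named fact, no axiom) by combining three inequalities of the
tree — Bernstein's inequality `BennettBernsteinMeasure.measureReal_le_sum_sub_integral_le_exp_bernstein`
(twice: for `X_i − μ ≤ b` and for `μ − X_i ≤ b`) and Maurer's sub-Gaussian lower tail for nonnegative
summands `NonnegativeLowerTail.measureReal_sum_le_sub_le_exp_of_nonneg` (once: for `(X_i − μ)²`) —
with a deterministic elimination of the unknown standard deviation (the private lemma `core`).

THE PRINTED RESULTS (statements VERBATIM from held texts; their constants are SHARPER than the ones
proved here, see «What is proved» below).
* [cite: MaurerPontil2009, Theorem 4] (A. Maurer, M. Pontil, *Empirical Bernstein bounds and sample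
  variance penalization*, COLT 2009, arXiv:0907.3740; held `paper:arxiv-0907.3740` p0004:L18–L33):
  "**Theorem 4.** Under the conditions of Theorem 1 [`Z, Z_1, …, Z_n` i.i.d. random variables with
  values in `[0,1]` and `δ > 0`] we have with probability at least `1 − δ` in the i.i.d. vector
  `Z = (Z_1, …, Z_n)` that `E Z − (1/n) Σ_{i=1}^n Z_i ≤ √(2 V_n(Z) ln(2/δ) / n) + 7 ln(2/δ)/(3(n−1))`,
  where `V_n(Z)` is the sample variance `V_n(Z) = (1/(n(n−1))) Σ_{1≤i<j≤n} (Z_i − Z_j)²`."  Its proof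
  (ibid. §2, Theorems 7, 10, 11) rests on a concentration inequality for SELF-BOUNDING functions
  (Maurer 2006, Theorem 13 = ibid. Theorem 7), which is NOT in the tree; p0004:L68–L71: "We note that
  an analogous result to Theorem 4 is given by Audibert et al. [Audibert 2007]. Our technique of proof
  is new and the bound we derive has a slightly better constant."; p0003:L111–L117 (the non-empirical
  ancestor): "**Theorem 3 (Bennett's inequality).** … with probability at least `1 − δ` …
  `E Z − (1/n) Σ Z_i ≤ √(2 𝕍Z ln(1/δ)/n) + ln(1/δ)/(3n)`".
* [cite: AudibertMunosSzepesvari2009, Theorem 1] (J.-Y. Audibert, R. Munos, Cs. Szepesvári, *Theor.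
  Comput. Sci.* 410 (2009) 1876–1902; paywalled, acquisition want acq-10538 — NOT consulted), as
  restated in the held text [cite: BardenetDoucetHolmes2014, eq. (9)] (R. Bardenet, A. Doucet,
  C. Holmes, ICML 2014, `paper:w1624701674` p0004:L9–L19): "a tighter bound known as the empirical
  Bernstein bound (Audibert et al., 2009) `c_t = σ̂_t √(2 log(3/δ_t)/t) + 6 C_{θ,θ'} log(3/δ_t)/t` (9)
  applies" (`σ̂_t` the empirical standard deviation of `t` terms bounded by `C_{θ,θ'}` in absolute
  value, i.e. of RANGE `2C_{θ,θ'}`; level `δ_t = 3e^{−x}`).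

WHAT IS PROVED HERE (same shape as (9) — empirical standard deviation with divisor `n`, three
exponential tails — with the range constant `5b` in place of the printed `3 × range`; M–P's
`7/(3(n−1))` with divisor-`(n−1)` variance is sharper still).  Setting: a probability space `(Ω, P)`,
`X : ι → Ω → ℝ` independent (`iIndepFun`) and measurable, `0 ≤ X_i ≤ b` pointwise (`b > 0`), a finite
nonempty index set `s` with `n = #s`, and a COMMON MEAN `E X_i = μ` for `i ∈ s` (identical distribution
is NOT required: the argument runs on the average variance `σ̄² = n⁻¹ Σ_{i∈s} Var X_i`).  Write
`X̄ = n⁻¹ Σ_{i∈s} X_i` and `V̂ = n⁻¹ Σ_{i∈s} (X_i − X̄)²`.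
* (private helpers) `sum_sq_sub_div_card_eq` — `Σ (X_i − X̄)² = Σ (X_i − μ)² − n (X̄ − μ)²` — and
  `core` — the deterministic elimination: if `σ ≤ b/2`, `0 ≤ D ≤ b`, `V ≥ 0`, `a > 0`,
  `D ≤ σa + (5/12) b a²` and `σ² ≤ V + D² + bσa + (1/12) b²a²`, then `D ≤ a√V + (5/2) b a²`;
* **`EmpiricalBernstein.measureReal_lt_abs_avg_sub_le`** — for every `x > 0`,
  `P{ √(2 V̂ x / n) + 5 b x / n < |X̄ − μ| } ≤ 3 e^{−x}`;
* `EmpiricalBernstein.measureReal_lt_abs_avg_sub_le_of_identDistrib` — the i.i.d. sequence form over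
  `Finset.range n`, `μ = E X_0`;
* (v2) the same two statements with the UNBIASED sample variance (divisor `n − 1`, as in M–P's `V_n`
  and in the tree's `Literature.Probability.Moments.sampleVariance` [cite: Lemieux2009, §6.2 eq. (6.1)]):
  `EmpiricalBernstein.measureReal_lt_abs_avg_sub_le_unbiased` (any finite index set; the bound only
  WEAKENS since `Σ(X_i − X̄)²/(n−1) ≥ Σ(X_i − X̄)²/n`, both `0` at `n = 1`) and
  **`EmpiricalBernstein.measureReal_lt_abs_sampleMean_sub_le`** (i.i.d. sequence, stated with the
  tree's `sampleMean` / `sampleVariance` of the first `n` draws: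
  `P{ √(2 · sampleVariance · x / n) + 5bx/n < |sampleMean − E X_0| } ≤ 3e^{−x}`).
Proof of the main theorem: with `a = √(2x/n)` (so `x = n a²/2`), Bernstein for `Σ(X_i − μ)` and for
`Σ(μ − X_i)` with variance proxy `v = nσ̄² + n b²a²/144` and level `t = √(2vx) + 2bx/3 ≤
n(σ̄a + (5/12) b a²)` (each tail `≤ e^{−x}`), Maurer's lower tail for `Σ(X_i − μ)²` (summands in
`[0, b²]`, `Σ E(X_i − μ)⁴ ≤ b² n σ̄²`) with proxy `b²nσ̄² + n b⁴a²/144` and level `√(2vx) ≤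
n(bσ̄a + b²a²/12)` (tail `≤ e^{−x}`; the `a²/144` paddings keep the proxies positive when `σ̄ = 0` and
cost the constant nothing that matters); off these three events `core` applies with
`D = |X̄ − μ|`, `V = V̂`, `σ = σ̄` (note `n⁻¹Σ(X_i − μ)² = V̂ + D²`).  Constants are not optimised.
NOT typed: Maurer–Pontil's Theorem 4 / 10 / 11 themselves (self-bounding route), the function-class
versions (their Corollary 5, Theorem 6).  Bennett's confidence form with `ln(1/δ)/(3n)` (M–P Theorem 3)
is the sibling file `BernsteinSubGamma.lean` (BLM Theorem 2.10 with `c = b/3`), filed after v1 of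
this one; using it in `core` would lower the `5` here to about `4` (not done: constants are not the
point of this file).

(Filed by the pub-qed literature seat as the kernel form of «with the range known the error bar is a
THEOREM for bounded i.i.d. draws at every n» (irse ideation card C24); VALUE-FREE, decides nothing.
independent recomputation; certified where stated, statistical where stated; no new-physics claim.)

## References
* [MaurerPontil2009] A. Maurer, M. Pontil, *Empirical Bernstein bounds and sample variance
  penalization*, COLT 2009, arXiv:0907.3740 — Theorems 3, 4 (p. 4), §2 Theorems 7, 10, 11.
* [AudibertMunosSzepesvari2009] J.-Y. Audibert, R. Munos, Cs. Szepesvári, *Exploration–exploitation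
  tradeoff using variance estimates in multi-armed bandits*, Theor. Comput. Sci. 410 (2009)
  1876–1902, Theorem 1 (cited through the next item and through [MaurerPontil2009]).
* [BardenetDoucetHolmes2014] R. Bardenet, A. Doucet, C. Holmes, *Towards scaling up Markov chain
  Monte Carlo: an adaptive subsampling approach*, ICML 2014, PMLR 32, eq. (9).
* [BoucheronLugosiMassart2013] S. Boucheron, G. Lugosi, P. Massart, *Concentration Inequalities*,
  OUP 2013, §2.7 eq. (2.10) (Bernstein), §2.11 Exercise 2.9 (Maurer's lower tail) — the tree inputs.
-/

noncomputable section

namespace Literature.Probability.Moments.EmpiricalBernstein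

open MeasureTheory ProbabilityTheory Finset Real

/-! ### Deterministic ingredients -/

/-- `√y ≤ c` as soon as `y ≤ c²` and `c ≥ 0`. [folklore] -/
private theorem sqrt_le_of_le_sq {y c : ℝ} (hc : 0 ≤ c) (h : y ≤ c ^ 2) : √y ≤ c := by
  calc √y ≤ √(c ^ 2) := Real.sqrt_le_sqrt h
    _ = c := Real.sqrt_sq hc

/-- **The centred sum of squares identity** `Σ_{i∈s} (x_i − x̄)² = Σ_{i∈s} (x_i − μ)² − n (x̄ − μ)²`
(`x̄ = n⁻¹ Σ x_i`, `n = #s ≠ 0`, `μ` arbitrary). [folklore] -/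
private theorem sum_sq_sub_div_card_eq {ι : Type*} (s : Finset ι) (x : ι → ℝ) (μ : ℝ)
    (hs : s.card ≠ 0) :
    ∑ i ∈ s, (x i - (∑ j ∈ s, x j) / s.card) ^ 2
      = ∑ i ∈ s, (x i - μ) ^ 2 - s.card * ((∑ j ∈ s, x j) / s.card - μ) ^ 2 := by
  have hn : (s.card : ℝ) ≠ 0 := Nat.cast_ne_zero.2 hs
  set A : ℝ := (∑ j ∈ s, x j) / s.card with hA
  have hsum : ∑ j ∈ s, x j = s.card * A := by rw [hA]; field_simp
  have key : ∀ i, (x i - A) ^ 2 = (x i - μ) ^ 2 + (A - μ) ^ 2 - (2 * (A - μ)) * (x i - μ) :=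
    fun i => by ring
  simp only [key, Finset.sum_sub_distrib, Finset.sum_add_distrib, ← Finset.mul_sum, Finset.sum_const,
    nsmul_eq_mul, hsum]
  ring

/-- **The deterministic elimination of the unknown standard deviation.**  If `a > 0`, `b > 0`,
`0 ≤ σ ≤ b/2`, `0 ≤ D ≤ b`, `V ≥ 0`, and
`D ≤ σ a + (5/12) b a²` (a Bernstein-type bound on the deviation `D` of the mean) and
`σ² ≤ V + D² + b σ a + (1/12) b² a²` (a lower-tail bound on the empirical second moment `V + D²`),
then `D ≤ a √V + (5/2) b a²` (`σ ≥ 0` is not even needed).  (For `(5/2) a² ≥ 1` the right-hand side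
already exceeds `b ≥ D`; otherwise `σ ≤ √V + D + (11/10) b a` by completing the square, and
`a D ≤ (7/9) b a²`.) [folklore] -/
private theorem core {a b σ D V : ℝ} (ha : 0 < a) (hb : 0 < b) (hσb : σ ≤ b / 2)
    (hD0 : 0 ≤ D) (hDb : D ≤ b) (hV : 0 ≤ V)
    (h1 : D ≤ σ * a + 5 / 12 * b * a ^ 2)
    (h2 : σ ^ 2 ≤ V + D ^ 2 + b * σ * a + 1 / 12 * b ^ 2 * a ^ 2) :
    D ≤ a * √V + 5 / 2 * b * a ^ 2 := by
  have hsV : 0 ≤ √V := Real.sqrt_nonneg V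
  have hba : 0 ≤ b * a := mul_nonneg hb.le ha.le
  by_cases hcase : 1 ≤ 5 / 2 * a ^ 2
  · have h3 : b ≤ 5 / 2 * b * a ^ 2 := by nlinarith
    nlinarith [mul_nonneg ha.le hsV]
  push Not at hcase
  have ha1 : a < 2 / 3 := by nlinarith
  -- completing the square in `h2`
  have hsq : (σ - b * a / 2) ^ 2 ≤ V + (D + 3 / 5 * (b * a)) ^ 2 := by
    nlinarith [mul_nonneg hD0 hba]
  have hσ : σ ≤ √V + D + 11 / 10 * (b * a) := by
    rcases le_or_gt (σ - b * a / 2) 0 with hneg | hpos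
    · linarith
    · have h3 : σ - b * a / 2 ≤ √(V + (D + 3 / 5 * (b * a)) ^ 2) := by
        rw [← Real.sqrt_sq hpos.le]
        exact Real.sqrt_le_sqrt hsq
      have h4 : √(V + (D + 3 / 5 * (b * a)) ^ 2) ≤ √V + (D + 3 / 5 * (b * a)) := by
        refine sqrt_le_of_le_sq (by positivity) ?_
        have hVs : V = √V ^ 2 := (Real.sq_sqrt hV).symm
        nlinarith [mul_nonneg hsV (add_nonneg hD0 (mul_nonneg (by norm_num : (0:ℝ) ≤ 3 / 5) hba))]
      linarith
  -- `a D ≤ (7/9) b a²`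
  have haD : a * D ≤ 7 / 9 * b * a ^ 2 := by
    have h5 : a * D ≤ a * (σ * a + 5 / 12 * b * a ^ 2) := mul_le_mul_of_nonneg_left h1 ha.le
    have h6 : a * (σ * a) ≤ b / 2 * a ^ 2 := by nlinarith [sq_nonneg a]
    have h7 : a * (5 / 12 * b * a ^ 2) ≤ 5 / 18 * b * a ^ 2 := by
      have : a * a ^ 2 ≤ 2 / 3 * a ^ 2 := by nlinarith [sq_nonneg a]
      nlinarith
    nlinarith
  -- substitute `hσ` into `h1`
  have h8 : σ * a ≤ (√V + D + 11 / 10 * (b * a)) * a := mul_le_mul_of_nonneg_right hσ ha.le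
  have h9 : D ≤ a * √V + a * D + (11 / 10 + 5 / 12) * b * a ^ 2 := by nlinarith
  nlinarith

/-! ### The probabilistic statement -/

variable {Ω : Type*} [MeasurableSpace Ω] {P : Measure Ω} [IsProbabilityMeasure P] {ι : Type*}

/-- For `S ≥ 0` with `S² = 2 v x` and `t = S + 2bx/3`: `x · 2(v + bt/3) ≤ t²`, the inversion of
Bernstein's exponent `t²/(2(v + bt/3))` at the level `t = √(2vx) + 2bx/3`. [folklore] -/
private theorem bernstein_level {v b x S : ℝ} (hb : 0 ≤ b) (hx : 0 ≤ x) (hS : 0 ≤ S)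
    (hS2 : S ^ 2 = 2 * v * x) :
    x * (2 * (v + b * (S + 2 * b * x / 3) / 3)) ≤ (S + 2 * b * x / 3) ^ 2 := by
  nlinarith [mul_nonneg (mul_nonneg hb hx) hS]

/-- **EMPIRICAL BERNSTEIN BOUND.**  Let `X_i` (`i ∈ ι`) be independent measurable random variables
with `0 ≤ X_i ≤ b` (`b > 0`), let `s` be a finite nonempty index set, `n = #s`, and suppose
`E X_i = μ` for all `i ∈ s`.  With `X̄ = n⁻¹ Σ_{i∈s} X_i` and the empirical variance
`V̂ = n⁻¹ Σ_{i∈s} (X_i − X̄)²`, for every `x > 0`: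
`P{ √(2 V̂ x / n) + 5 b x / n < |X̄ − μ| } ≤ 3 e^{−x}` — i.e. `|X̄ − μ| ≤ σ̂ √(2x/n) + 5bx/n` with
probability at least `1 − 3e^{−x}`, a fully data-dependent bound (the printed bounds of this shape
carry `3 × range` [Audibert–Munos–Szepesvári] resp. `7/(3(n−1))` with the divisor-`(n−1)` variance
[Maurer–Pontil, range 1] in the second term; this file's `5b` is what the elementary route gives).
[cite: MaurerPontil2009, Theorem 4] [cite: BardenetDoucetHolmes2014, eq. (9)]
[cite: AudibertMunosSzepesvari2009, Theorem 1] -/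
theorem measureReal_lt_abs_avg_sub_le {X : ι → Ω → ℝ} (hind : iIndepFun X P)
    (hXm : ∀ i, Measurable (X i)) {b : ℝ} (hb : 0 < b) (hX0 : ∀ i ω, 0 ≤ X i ω)
    (hXb : ∀ i ω, X i ω ≤ b) (s : Finset ι) (hs : s.Nonempty) {μ : ℝ}
    (hμ : ∀ i ∈ s, ∫ ω, X i ω ∂P = μ) {x : ℝ} (hx : 0 < x) :
    P.real {ω | √(2 * ((∑ i ∈ s, (X i ω - (∑ j ∈ s, X j ω) / s.card) ^ 2) / s.card) * x / s.card)
        + 5 * b * x / s.card < |(∑ i ∈ s, X i ω) / s.card - μ|} ≤ 3 * exp (-x) := by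
  classical
  -- ### bookkeeping
  have hcard : s.card ≠ 0 := (Finset.card_pos.2 hs).ne'
  obtain ⟨n, hn_def⟩ : ∃ n : ℝ, n = (s.card : ℝ) := ⟨_, rfl⟩
  have hn : 0 < n := by rw [hn_def]; exact_mod_cast Finset.card_pos.2 hs
  have hn0 : n ≠ 0 := hn.ne'
  obtain ⟨i₀, hi₀⟩ := hs
  have hXmem : ∀ i (p : ENNReal), MemLp (X i) p P := fun i p =>
    memLp_of_bounded (a := 0) (b := b) (ae_of_all _ fun ω => ⟨hX0 i ω, hXb i ω⟩)
      (hXm i).aestronglyMeasurable p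
  have hXint : ∀ i, Integrable (X i) P := fun i => (hXmem i 1).integrable le_rfl
  have hμ0 : 0 ≤ μ := by rw [← hμ i₀ hi₀]; exact integral_nonneg (hX0 i₀)
  have hμb : μ ≤ b := by
    rw [← hμ i₀ hi₀]
    calc ∫ ω, X i₀ ω ∂P ≤ ∫ _ω, b ∂P := integral_mono (hXint i₀) (integrable_const b) (hXb i₀)
      _ = b := by simp
  -- pointwise facts about the centred variables
  have hYb : ∀ i ω, X i ω - μ ≤ b := fun i ω => by linarith [hXb i ω]
  have hY'b : ∀ i ω, μ - X i ω ≤ b := fun i ω => by linarith [hX0 i ω]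
  have hYsq : ∀ i ω, (X i ω - μ) ^ 2 ≤ b ^ 2 := fun i ω =>
    sq_le_sq' (by linarith [hY'b i ω]) (hYb i ω)
  -- ### the average variance `σ̄²` and `a = √(2x/n)`
  obtain ⟨σ2, hσ2_def⟩ : ∃ σ2 : ℝ, σ2 = (∑ i ∈ s, ∫ ω, (X i ω - μ) ^ 2 ∂P) / n := ⟨_, rfl⟩
  have hsumσ : ∑ i ∈ s, ∫ ω, (X i ω - μ) ^ 2 ∂P = n * σ2 := by rw [hσ2_def]; field_simp
  have hW_int : ∀ i, Integrable (fun ω => (X i ω - μ) ^ 2) P := fun i =>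
    ((hXmem i 2).sub (memLp_const μ)).integrable_sq
  have hvar_i : ∀ i ∈ s, ∫ ω, (X i ω - μ) ^ 2 ∂P ≤ b ^ 2 / 4 := by
    intro i hi
    -- `(t − μ)² ≤ (b − 2μ) t + μ²` on `[0, b]`, integrate, then `μ(b − μ) ≤ b²/4`
    have hpt : ∀ ω, (X i ω - μ) ^ 2 ≤ (b - 2 * μ) * X i ω + μ ^ 2 := fun ω => by
      nlinarith only [hX0 i ω, hXb i ω]
    calc ∫ ω, (X i ω - μ) ^ 2 ∂P ≤ ∫ ω, ((b - 2 * μ) * X i ω + μ ^ 2) ∂P :=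
          integral_mono (hW_int i) (((hXint i).const_mul _).add (integrable_const _)) hpt
      _ = (b - 2 * μ) * μ + μ ^ 2 := by
          rw [integral_add ((hXint i).const_mul _) (integrable_const _), integral_const_mul,
            hμ i hi]
          simp
      _ ≤ b ^ 2 / 4 := by nlinarith only [sq_nonneg (μ - b / 2)]
  have hσ2_0 : 0 ≤ σ2 := by
    rw [hσ2_def]
    exact div_nonneg (Finset.sum_nonneg fun i _ => integral_nonneg fun ω => sq_nonneg _) hn.le
  have hσ2_le : σ2 ≤ b ^ 2 / 4 := by
    rw [hσ2_def, div_le_iff₀ hn]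
    calc ∑ i ∈ s, ∫ ω, (X i ω - μ) ^ 2 ∂P ≤ ∑ _i ∈ s, b ^ 2 / 4 := Finset.sum_le_sum hvar_i
      _ = b ^ 2 / 4 * n := by rw [Finset.sum_const, nsmul_eq_mul, hn_def]; ring
  obtain ⟨σ, hσ_def⟩ : ∃ σ : ℝ, σ = √σ2 := ⟨_, rfl⟩
  have hσ0 : 0 ≤ σ := by rw [hσ_def]; exact Real.sqrt_nonneg _
  have hσsq : σ ^ 2 = σ2 := by rw [hσ_def]; exact Real.sq_sqrt hσ2_0
  have hσb : σ ≤ b / 2 := by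
    rw [hσ_def]
    refine sqrt_le_of_le_sq (by linarith) ?_
    have : (b / 2) ^ 2 = b ^ 2 / 4 := by ring
    rw [this]; exact hσ2_le
  have h2xn : 0 < 2 * x / n := div_pos (by linarith) hn
  obtain ⟨a, ha_def⟩ : ∃ a : ℝ, a = √(2 * x / n) := ⟨_, rfl⟩
  have ha : 0 < a := by rw [ha_def]; exact Real.sqrt_pos.2 h2xn
  have hasq : a ^ 2 = 2 * x / n := by rw [ha_def]; exact Real.sq_sqrt h2xn.le
  have hxa : x = n * a ^ 2 / 2 := by rw [hasq]; field_simp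
  have hba : 0 < b * a := mul_pos hb ha
  -- ### Event A: Bernstein for `Σ (X_i − μ)` and for `Σ (μ − X_i)`
  obtain ⟨vA, hvA_def⟩ : ∃ v : ℝ, v = n * σ2 + n * b ^ 2 * a ^ 2 / 144 := ⟨_, rfl⟩
  have hvA : 0 < vA := by
    rw [hvA_def]
    have h1 : 0 ≤ n * σ2 := mul_nonneg hn.le hσ2_0
    have h2 : 0 < n * b ^ 2 * a ^ 2 / 144 := by positivity
    linarith
  obtain ⟨SA, hSA_def⟩ : ∃ S : ℝ, S = √(2 * vA * x) := ⟨_, rfl⟩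
  have hSA0 : 0 ≤ SA := by rw [hSA_def]; exact Real.sqrt_nonneg _
  have h2vx : 0 ≤ 2 * vA * x := by positivity
  have hSA2 : SA ^ 2 = 2 * vA * x := by rw [hSA_def]; exact Real.sq_sqrt h2vx
  obtain ⟨tA, htA_def⟩ : ∃ t : ℝ, t = SA + 2 * b * x / 3 := ⟨_, rfl⟩
  have htA : 0 < tA := by rw [htA_def]; positivity
  -- `tA ≤ n (σ a + (5/12) b a²)`
  have hSA_le : SA ≤ n * a * σ + n * b * a ^ 2 / 12 := by
    have hP : 0 ≤ n * a * σ := mul_nonneg (mul_nonneg hn.le ha.le) hσ0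
    have hQ : 0 ≤ n * b * a ^ 2 / 12 := by
      have := mul_nonneg (mul_nonneg hn.le hb.le) (sq_nonneg a); linarith
    rw [hSA_def]
    refine sqrt_le_of_le_sq (add_nonneg hP hQ) ?_
    have h1 : 2 * vA * x = (n * a * σ) ^ 2 + (n * b * a ^ 2 / 12) ^ 2 := by
      rw [hvA_def, hxa, ← hσsq]; ring
    have h2 : (n * a * σ + n * b * a ^ 2 / 12) ^ 2
        = (n * a * σ) ^ 2 + (n * b * a ^ 2 / 12) ^ 2 + 2 * ((n * a * σ) * (n * b * a ^ 2 / 12)) := by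
      ring
    rw [h1, h2]
    linarith [mul_nonneg hP hQ]
  have htA_le : tA ≤ n * (σ * a + 5 / 12 * b * a ^ 2) := by
    have h1 : 2 * b * x / 3 = n * b * a ^ 2 / 3 := by rw [hxa]; ring
    have h2 : n * (σ * a + 5 / 12 * b * a ^ 2) = (n * a * σ + n * b * a ^ 2 / 12) + n * b * a ^ 2 / 3 := by
      ring
    rw [htA_def, h1, h2]
    linarith [hSA_le]
  have hexpA : exp (-(tA ^ 2 / (2 * (vA + b * tA / 3)))) ≤ exp (-x) := by
    refine exp_le_exp.2 (neg_le_neg ?_)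
    have hden : 0 < 2 * (vA + b * tA / 3) := by positivity
    rw [le_div_iff₀ hden, htA_def]
    exact bernstein_level hb.le hx.le hSA0 hSA2
  -- independence and moments of the centred families
  have hindY : iIndepFun (fun i ω => X i ω - μ) P :=
    hind.comp (fun _ (t : ℝ) => t - μ) fun _ => measurable_id.sub_const μ
  have hindY' : iIndepFun (fun i ω => μ - X i ω) P :=
    hind.comp (fun _ (t : ℝ) => μ - t) fun _ => measurable_const.sub measurable_id
  have hindW : iIndepFun (fun i ω => (X i ω - μ) ^ 2) P :=
    hind.comp (fun _ (t : ℝ) => (t - μ) ^ 2) fun _ => (measurable_id.sub_const μ).pow_const 2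
  have hYmem : ∀ i, MemLp (fun ω => X i ω - μ) 2 P := fun i => (hXmem i 2).sub (memLp_const μ)
  have hY'mem : ∀ i, MemLp (fun ω => μ - X i ω) 2 P := fun i => (memLp_const μ).sub (hXmem i 2)
  have hWmem : ∀ i, MemLp (fun ω => (X i ω - μ) ^ 2) 2 P := fun i =>
    memLp_of_bounded (a := 0) (b := b ^ 2) (ae_of_all _ fun ω => ⟨sq_nonneg _, hYsq i ω⟩)
      (((hXm i).sub_const μ).pow_const 2).aestronglyMeasurable 2
  have hYint0 : ∀ i ∈ s, ∫ ω, (X i ω - μ) ∂P = 0 := fun i hi => by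
    rw [integral_sub (hXint i) (integrable_const μ), hμ i hi]; simp
  have hY'int0 : ∀ i ∈ s, ∫ ω, (μ - X i ω) ∂P = 0 := fun i hi => by
    rw [integral_sub (integrable_const μ) (hXint i), hμ i hi]; simp
  have hYv : ∑ i ∈ s, ∫ ω, (X i ω - μ) ^ 2 ∂P ≤ vA := by
    rw [hsumσ, hvA_def]
    have := mul_nonneg (mul_nonneg hn.le (sq_nonneg b)) (sq_nonneg a)
    linarith
  have hY'v : ∑ i ∈ s, ∫ ω, (μ - X i ω) ^ 2 ∂P ≤ vA := by
    have : ∀ i, ∫ ω, (μ - X i ω) ^ 2 ∂P = ∫ ω, (X i ω - μ) ^ 2 ∂P := fun i => by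
      congr 1; ext ω; ring
    rw [Finset.sum_congr rfl fun i _ => this i]; exact hYv
  have hA : P.real {ω | tA ≤ ∑ i ∈ s, (X i ω - μ)} ≤ exp (-x) := by
    have h := measureReal_le_sum_sub_integral_le_exp_bernstein hindY hYmem hb
      (fun i => ae_of_all _ (hYb i)) s hvA hYv htA
    have hset : {ω | tA ≤ ∑ i ∈ s, (X i ω - μ)}
        = {ω | tA ≤ ∑ i ∈ s, ((X i ω - μ) - ∫ ω', (X i ω' - μ) ∂P)} := by
      ext ω; simp only [Set.mem_setOf_eq]
      rw [Finset.sum_congr rfl fun i hi =>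
        show (X i ω - μ) - ∫ ω', (X i ω' - μ) ∂P = X i ω - μ by rw [hYint0 i hi, sub_zero]]
    rw [hset]; exact h.trans hexpA
  have hA' : P.real {ω | tA ≤ ∑ i ∈ s, (μ - X i ω)} ≤ exp (-x) := by
    have h := measureReal_le_sum_sub_integral_le_exp_bernstein hindY' hY'mem hb
      (fun i => ae_of_all _ (hY'b i)) s hvA hY'v htA
    have hset : {ω | tA ≤ ∑ i ∈ s, (μ - X i ω)}
        = {ω | tA ≤ ∑ i ∈ s, ((μ - X i ω) - ∫ ω', (μ - X i ω') ∂P)} := by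
      ext ω; simp only [Set.mem_setOf_eq]
      rw [Finset.sum_congr rfl fun i hi =>
        show (μ - X i ω) - ∫ ω', (μ - X i ω') ∂P = μ - X i ω by rw [hY'int0 i hi, sub_zero]]
    rw [hset]; exact h.trans hexpA
  -- ### Event B: Maurer's lower tail for `Σ (X_i − μ)²`
  obtain ⟨vB, hvB_def⟩ : ∃ v : ℝ, v = b ^ 2 * (n * σ2) + n * b ^ 4 * a ^ 2 / 144 := ⟨_, rfl⟩
  have hvB : 0 < vB := by
    rw [hvB_def]
    have h1 : 0 ≤ b ^ 2 * (n * σ2) := mul_nonneg (sq_nonneg b) (mul_nonneg hn.le hσ2_0)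
    have h2 : 0 < n * b ^ 4 * a ^ 2 / 144 := by positivity
    linarith
  obtain ⟨tB, htB_def⟩ : ∃ t : ℝ, t = √(2 * vB * x) := ⟨_, rfl⟩
  have htB0 : 0 ≤ tB := by rw [htB_def]; exact Real.sqrt_nonneg _
  have htB2 : tB ^ 2 = 2 * vB * x := by rw [htB_def]; exact Real.sq_sqrt (by positivity)
  have htB_le : tB ≤ n * a * b * σ + n * b ^ 2 * a ^ 2 / 12 := by
    have hP : 0 ≤ n * a * b * σ := mul_nonneg (mul_nonneg (mul_nonneg hn.le ha.le) hb.le) hσ0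
    have hQ : 0 ≤ n * b ^ 2 * a ^ 2 / 12 := by
      have := mul_nonneg (mul_nonneg hn.le (sq_nonneg b)) (sq_nonneg a); linarith
    rw [htB_def]
    refine sqrt_le_of_le_sq (add_nonneg hP hQ) ?_
    have h1 : 2 * vB * x = (n * a * b * σ) ^ 2 + (n * b ^ 2 * a ^ 2 / 12) ^ 2 := by
      rw [hvB_def, hxa, ← hσsq]; ring
    have h2 : (n * a * b * σ + n * b ^ 2 * a ^ 2 / 12) ^ 2
        = (n * a * b * σ) ^ 2 + (n * b ^ 2 * a ^ 2 / 12) ^ 2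
          + 2 * ((n * a * b * σ) * (n * b ^ 2 * a ^ 2 / 12)) := by ring
    rw [h1, h2]
    linarith [mul_nonneg hP hQ]
  have hWv : ∑ i ∈ s, ∫ ω, ((X i ω - μ) ^ 2) ^ 2 ∂P ≤ vB := by
    have hle : ∀ i ∈ s, ∫ ω, ((X i ω - μ) ^ 2) ^ 2 ∂P ≤ b ^ 2 * ∫ ω, (X i ω - μ) ^ 2 ∂P := by
      intro i _
      rw [← integral_const_mul]
      refine integral_mono ((hWmem i).integrable_sq) ((hW_int i).const_mul _) fun ω => ?_
      have h1 := hYsq i ω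
      have h2 := sq_nonneg (X i ω - μ)
      calc ((X i ω - μ) ^ 2) ^ 2 = (X i ω - μ) ^ 2 * (X i ω - μ) ^ 2 := sq _
        _ ≤ b ^ 2 * (X i ω - μ) ^ 2 := mul_le_mul_of_nonneg_right h1 h2
    calc ∑ i ∈ s, ∫ ω, ((X i ω - μ) ^ 2) ^ 2 ∂P ≤ ∑ i ∈ s, b ^ 2 * ∫ ω, (X i ω - μ) ^ 2 ∂P :=
          Finset.sum_le_sum hle
      _ = b ^ 2 * (n * σ2) := by rw [← Finset.mul_sum, hsumσ]
      _ ≤ vB := by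
          rw [hvB_def]
          have := mul_nonneg (mul_nonneg hn.le (pow_nonneg hb.le 4)) (sq_nonneg a)
          linarith
  have hB : P.real {ω | ∑ i ∈ s, (X i ω - μ) ^ 2 ≤ n * σ2 - tB} ≤ exp (-x) := by
    have h := measureReal_sum_le_sub_le_exp_of_nonneg hindW hWmem
      (fun i => ae_of_all _ fun ω => sq_nonneg (X i ω - μ)) s hWv htB0
    rw [hsumσ] at h
    refine h.trans (le_of_eq ?_)
    congr 1
    rw [htB2]; field_simp
  -- ### the bad event is contained in the union of the three
  have hsub : {ω | √(2 * ((∑ i ∈ s, (X i ω - (∑ j ∈ s, X j ω) / s.card) ^ 2) / s.card) * x / s.card)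
        + 5 * b * x / s.card < |(∑ i ∈ s, X i ω) / s.card - μ|}
      ⊆ ({ω | tA ≤ ∑ i ∈ s, (X i ω - μ)} ∪ {ω | tA ≤ ∑ i ∈ s, (μ - X i ω)})
        ∪ {ω | ∑ i ∈ s, (X i ω - μ) ^ 2 ≤ n * σ2 - tB} := by
    intro ω hω
    simp only [Set.mem_setOf_eq, Set.mem_union] at hω ⊢
    by_contra hnot
    push Not at hnot
    obtain ⟨⟨hnA, hnA'⟩, hnB⟩ := hnot
    rw [← hn_def] at hω
    -- the quantities of `core`
    obtain ⟨A, hA_def⟩ : ∃ A : ℝ, A = (∑ j ∈ s, X j ω) / n := ⟨_, rfl⟩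
    obtain ⟨D, hD_def⟩ : ∃ D : ℝ, D = |A - μ| := ⟨_, rfl⟩
    obtain ⟨V, hV_def⟩ : ∃ V : ℝ, V = (∑ i ∈ s, (X i ω - A) ^ 2) / n := ⟨_, rfl⟩
    obtain ⟨M, hM_def⟩ : ∃ M : ℝ, M = (∑ i ∈ s, (X i ω - μ) ^ 2) / n := ⟨_, rfl⟩
    have hsumX : ∑ j ∈ s, X j ω = n * A := by rw [hA_def]; field_simp
    have hsumW : ∑ i ∈ s, (X i ω - μ) ^ 2 = n * M := by rw [hM_def]; field_simp
    have hV0 : 0 ≤ V := by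
      rw [hV_def]; exact div_nonneg (Finset.sum_nonneg fun i _ => sq_nonneg _) hn.le
    have hA0 : 0 ≤ A := by
      rw [hA_def]; exact div_nonneg (Finset.sum_nonneg fun i _ => hX0 i ω) hn.le
    have hAb : A ≤ b := by
      rw [hA_def, div_le_iff₀ hn]
      calc ∑ j ∈ s, X j ω ≤ ∑ _j ∈ s, b := Finset.sum_le_sum fun j _ => hXb j ω
        _ = b * n := by rw [Finset.sum_const, nsmul_eq_mul, hn_def]; ring
    have hD0 : 0 ≤ D := by rw [hD_def]; exact abs_nonneg _
    have hDb : D ≤ b := by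
      rw [hD_def, abs_sub_le_iff]; constructor <;> linarith
    have hid : ∑ i ∈ s, (X i ω - A) ^ 2 = ∑ i ∈ s, (X i ω - μ) ^ 2 - n * (A - μ) ^ 2 := by
      have h := sum_sq_sub_div_card_eq s (fun i => X i ω) μ hcard
      simp only [← hn_def] at h
      rw [← hA_def] at h
      exact h
    have hMVD : M = V + D ^ 2 := by
      rw [hM_def, hV_def, hD_def, sq_abs, hid]
      field_simp
      ring
    -- (1) from `¬A` and `¬A'`
    have h1 : D ≤ σ * a + 5 / 12 * b * a ^ 2 := by
      have hS1 : ∑ i ∈ s, (X i ω - μ) = n * (A - μ) := by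
        rw [Finset.sum_sub_distrib, hsumX, Finset.sum_const, nsmul_eq_mul, ← hn_def]; ring
      have hS2 : ∑ i ∈ s, (μ - X i ω) = n * (μ - A) := by
        rw [Finset.sum_sub_distrib, hsumX, Finset.sum_const, nsmul_eq_mul, ← hn_def]; ring
      rw [hS1] at hnA
      rw [hS2] at hnA'
      have hu : A - μ < σ * a + 5 / 12 * b * a ^ 2 := by
        by_contra hc; push Not at hc
        exact (not_le.2 hnA) (htA_le.trans (mul_le_mul_of_nonneg_left hc hn.le))
      have hl : μ - A < σ * a + 5 / 12 * b * a ^ 2 := by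
        by_contra hc; push Not at hc
        exact (not_le.2 hnA') (htA_le.trans (mul_le_mul_of_nonneg_left hc hn.le))
      rw [hD_def]
      exact (abs_sub_lt_iff.2 ⟨hu, hl⟩).le
    -- (2) from `¬B`
    have h2 : σ ^ 2 ≤ V + D ^ 2 + b * σ * a + 1 / 12 * b ^ 2 * a ^ 2 := by
      rw [hsumW] at hnB
      have h2' : n * σ2 ≤ n * (M + b * σ * a + 1 / 12 * b ^ 2 * a ^ 2) := by
        have h3 : n * (M + b * σ * a + 1 / 12 * b ^ 2 * a ^ 2)
            = n * M + (n * a * b * σ + n * b ^ 2 * a ^ 2 / 12) := by ring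
        rw [h3]
        linarith [hnB, htB_le]
      rw [hσsq, ← hMVD]
      exact le_of_mul_le_mul_left h2' hn
    have hcore := core ha hb hσb hD0 hDb hV0 h1 h2
    -- contradiction with `hω`
    have hlhs : √(2 * V * x / n) + 5 * b * x / n = a * √V + 5 / 2 * b * a ^ 2 := by
      have : 2 * V * x / n = (2 * x / n) * V := by ring
      rw [this, Real.sqrt_mul h2xn.le, ← ha_def, hxa]
      field_simp
    have hω' : √(2 * V * x / n) + 5 * b * x / n < D := by
      rw [hV_def, hD_def, hA_def]; exact hω
    linarith
  -- ### union bound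
  calc P.real {ω | √(2 * ((∑ i ∈ s, (X i ω - (∑ j ∈ s, X j ω) / s.card) ^ 2) / s.card) * x / s.card)
          + 5 * b * x / s.card < |(∑ i ∈ s, X i ω) / s.card - μ|}
      ≤ P.real (({ω | tA ≤ ∑ i ∈ s, (X i ω - μ)} ∪ {ω | tA ≤ ∑ i ∈ s, (μ - X i ω)})
          ∪ {ω | ∑ i ∈ s, (X i ω - μ) ^ 2 ≤ n * σ2 - tB}) := measureReal_mono hsub
    _ ≤ P.real ({ω | tA ≤ ∑ i ∈ s, (X i ω - μ)} ∪ {ω | tA ≤ ∑ i ∈ s, (μ - X i ω)})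
          + P.real {ω | ∑ i ∈ s, (X i ω - μ) ^ 2 ≤ n * σ2 - tB} := measureReal_union_le _ _
    _ ≤ (P.real {ω | tA ≤ ∑ i ∈ s, (X i ω - μ)} + P.real {ω | tA ≤ ∑ i ∈ s, (μ - X i ω)})
          + P.real {ω | ∑ i ∈ s, (X i ω - μ) ^ 2 ≤ n * σ2 - tB} :=
        add_le_add (measureReal_union_le _ _) le_rfl
    _ ≤ (exp (-x) + exp (-x)) + exp (-x) := add_le_add (add_le_add hA hA') hB
    _ = 3 * exp (-x) := by ring

/-- **Empirical Bernstein bound, i.i.d. sequence form.**  For an i.i.d. sequence `X_0, X_1, …`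
(`iIndepFun` + `IdentDistrib (X i) (X 0)`), measurable, with values in `[0, b]` (`b > 0`), every
`n ≥ 1` and every `x > 0`: with `X̄_n = n⁻¹ Σ_{i<n} X_i`, `V̂_n = n⁻¹ Σ_{i<n} (X_i − X̄_n)²`,
`P{ √(2 V̂_n x / n) + 5 b x / n < |X̄_n − E X_0| } ≤ 3 e^{−x}`.
[cite: MaurerPontil2009, Theorem 4] [cite: BardenetDoucetHolmes2014, eq. (9)] -/
theorem measureReal_lt_abs_avg_sub_le_of_identDistrib {X : ℕ → Ω → ℝ} (hind : iIndepFun X P)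
    (hXm : ∀ i, Measurable (X i)) {b : ℝ} (hb : 0 < b) (hX0 : ∀ i ω, 0 ≤ X i ω)
    (hXb : ∀ i ω, X i ω ≤ b) (hident : ∀ i, IdentDistrib (X i) (X 0) P P) {n : ℕ} (hn : n ≠ 0)
    {x : ℝ} (hx : 0 < x) :
    P.real {ω | √(2 * ((∑ i ∈ range n, (X i ω - (∑ j ∈ range n, X j ω) / n) ^ 2) / n) * x / n)
        + 5 * b * x / n < |(∑ i ∈ range n, X i ω) / n - ∫ ω', X 0 ω' ∂P|} ≤ 3 * exp (-x) := by
  have h := measureReal_lt_abs_avg_sub_le hind hXm hb hX0 hXb (range n)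
    (Finset.nonempty_range_iff.2 hn) (μ := ∫ ω', X 0 ω' ∂P)
    (fun i _ => (hident i).integral_eq) hx
  simpa only [Finset.card_range] using h

/-! ### v2. The unbiased sample variance (divisor `n − 1`) and the tree's `sampleMean` / `sampleVariance`

Maurer–Pontil's `V_n(Z) = (1/(n(n−1))) Σ_{i<j} (Z_i − Z_j)²` is the UNBIASED sample variance
`Σ_i (Z_i − Z̄)²/(n − 1)`, which is also the tree's `Literature.Probability.Moments.sampleVariance`
[cite: Lemieux2009, §6.2 eq. (6.1)].  Since `Σ(X_i − X̄)²/(n − 1) ≥ Σ(X_i − X̄)²/n` for `n ≥ 2` (and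
both vanish for `n = 1`, Lean's `x/0 = 0`), the bound of `measureReal_lt_abs_avg_sub_le` holds verbatim
with the unbiased variance in place of `V̂`. -/

/-- For a one-element index set the centred sum of squares vanishes. [folklore] -/
private theorem sum_sq_sub_div_eq_zero_of_card_eq_one {ι : Type*} (s : Finset ι) (x : ι → ℝ)
    (hs : s.card = 1) : ∑ i ∈ s, (x i - (∑ j ∈ s, x j) / s.card) ^ 2 = 0 := by
  obtain ⟨a, rfl⟩ := Finset.card_eq_one.1 hs
  simp

/-- `Σ(x_i − x̄)²/n ≤ Σ(x_i − x̄)²/(n − 1)` for every finite index set (`n = #s`; both sides `0` when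
`n ≤ 1`). [folklore] -/
private theorem sum_sq_sub_div_card_le_div_pred {ι : Type*} (s : Finset ι) (x : ι → ℝ) :
    (∑ i ∈ s, (x i - (∑ j ∈ s, x j) / s.card) ^ 2) / s.card
      ≤ (∑ i ∈ s, (x i - (∑ j ∈ s, x j) / s.card) ^ 2) / ((s.card : ℝ) - 1) := by
  have hQ : 0 ≤ ∑ i ∈ s, (x i - (∑ j ∈ s, x j) / s.card) ^ 2 :=
    Finset.sum_nonneg fun i _ => sq_nonneg _
  rcases Nat.lt_or_ge s.card 2 with h | h
  · -- `#s ≤ 1`: both sides vanish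
    rcases Nat.lt_or_ge s.card 1 with h0 | h1
    · have hs0 : s = ∅ := Finset.card_eq_zero.1 (by omega)
      subst hs0
      simp
    · have hs1 : s.card = 1 := by omega
      rw [sum_sq_sub_div_eq_zero_of_card_eq_one s x hs1]
      simp
  · have h2 : (2 : ℝ) ≤ s.card := by exact_mod_cast h
    exact div_le_div_of_nonneg_left hQ (by linarith) (by linarith)

/-- **Empirical Bernstein bound with the unbiased sample variance** (divisor `n − 1`): under the
hypotheses of `measureReal_lt_abs_avg_sub_le`, for every `x > 0`,
`P{ √(2 V x / n) + 5 b x / n < |X̄ − μ| } ≤ 3 e^{−x}` with `V = Σ_{i∈s}(X_i − X̄)²/(n − 1)`.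
[cite: MaurerPontil2009, Theorem 4] [cite: BardenetDoucetHolmes2014, eq. (9)] -/
theorem measureReal_lt_abs_avg_sub_le_unbiased {X : ι → Ω → ℝ} (hind : iIndepFun X P)
    (hXm : ∀ i, Measurable (X i)) {b : ℝ} (hb : 0 < b) (hX0 : ∀ i ω, 0 ≤ X i ω)
    (hXb : ∀ i ω, X i ω ≤ b) (s : Finset ι) (hs : s.Nonempty) {μ : ℝ}
    (hμ : ∀ i ∈ s, ∫ ω, X i ω ∂P = μ) {x : ℝ} (hx : 0 < x) :
    P.real {ω | √(2 * ((∑ i ∈ s, (X i ω - (∑ j ∈ s, X j ω) / s.card) ^ 2) / ((s.card : ℝ) - 1))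
        * x / s.card) + 5 * b * x / s.card < |(∑ i ∈ s, X i ω) / s.card - μ|} ≤ 3 * exp (-x) := by
  refine le_trans (measureReal_mono (fun ω hω => ?_))
    (measureReal_lt_abs_avg_sub_le hind hXm hb hX0 hXb s hs hμ hx)
  simp only [Set.mem_setOf_eq] at hω ⊢
  refine lt_of_le_of_lt ?_ hω
  have hn : (0 : ℝ) ≤ s.card := Nat.cast_nonneg _
  have hle := sum_sq_sub_div_card_le_div_pred s (fun i => X i ω)
  gcongr

/-- **Empirical Bernstein bound in the tree's `sampleMean` / `sampleVariance` vocabulary** (i.i.d.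
sequence, first `n` draws, unbiased sample variance with divisor `n − 1`): for `X_0, X_1, …` i.i.d.
(`iIndepFun` + `IdentDistrib (X i) (X 0)`), measurable, with values in `[0, b]` (`b > 0`), every
`n ≥ 1` and `x > 0`,
`P{ √(2 · sampleVariance (X_0..X_{n−1}) · x / n) + 5 b x / n < |sampleMean (X_0..X_{n−1}) − E X_0| }
≤ 3 e^{−x}`. [cite: MaurerPontil2009, Theorem 4] [cite: Lemieux2009, §6.2 eq. (6.1)]
[cite: BardenetDoucetHolmes2014, eq. (9)] -/
theorem measureReal_lt_abs_sampleMean_sub_le {X : ℕ → Ω → ℝ} (hind : iIndepFun X P)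
    (hXm : ∀ i, Measurable (X i)) {b : ℝ} (hb : 0 < b) (hX0 : ∀ i ω, 0 ≤ X i ω)
    (hXb : ∀ i ω, X i ω ≤ b) (hident : ∀ i, IdentDistrib (X i) (X 0) P P) {n : ℕ} (hn : n ≠ 0)
    {x : ℝ} (hx : 0 < x) :
    P.real {ω | √(2 * sampleVariance (fun l : Fin n => X l) ω * x / n) + 5 * b * x / n
        < |sampleMean (fun l : Fin n => X l) ω - ∫ ω', X 0 ω' ∂P|} ≤ 3 * exp (-x) := by
  have h := measureReal_lt_abs_avg_sub_le_unbiased hind hXm hb hX0 hXb (range n)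
    (Finset.nonempty_range_iff.2 hn) (μ := ∫ ω', X 0 ω' ∂P)
    (fun i _ => (hident i).integral_eq) hx
  have hset : {ω | √(2 * sampleVariance (fun l : Fin n => X l) ω * x / n) + 5 * b * x / n
        < |sampleMean (fun l : Fin n => X l) ω - ∫ ω', X 0 ω' ∂P|}
      = {ω | √(2 * ((∑ i ∈ range n, (X i ω - (∑ j ∈ range n, X j ω) / (range n).card) ^ 2)
          / (((range n).card : ℝ) - 1)) * x / (range n).card) + 5 * b * x / (range n).card
          < |(∑ i ∈ range n, X i ω) / (range n).card - ∫ ω', X 0 ω' ∂P|} := by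
    ext ω
    simp only [Set.mem_setOf_eq, sampleVariance, sampleMean, Finset.card_range,
      Finset.sum_range (fun i => X i ω), Finset.sum_range (fun i => (X i ω - (∑ j : Fin n, X j ω) / n) ^ 2)]
  rw [hset]
  exact h

end Literature.Probability.Moments.EmpiricalBernstein

end
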